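import Literature.AnabelianGeometry.AbsoluteAnabelian.MonoidKummerMapsProp32iH2IsoEqStd
import Literature.AnabelianGeometry.AbsoluteAnabelian.MLFGaloisMonoAnalyticModel
import HarnessLib

/-!
# [AbsTopIII] Prop 3.2 (i) `H2IsoEq` for EVERY closure datum and EVERY abstract MLF-Galois `TM`-pair

S. Mochizuki, *Topics in absolute anabelian geometry III* (2015), Prop. 3.2 (i) p. 71: for an MLF-Galois `TM`-pair
`(Π ↷ M_TM)`, «the natural isomorphism `H²(G, μ_Ẑ(M_TM)) ⥲ Ẑ`» IS the Brauer chain to «`H²(G, μ_{ℚ/ℤ}(M_TM)) ⥲ ℚ/ℤ`»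
followed by «applying the functor `Hom(ℚ/ℤ, −)`» — the chain statement `Prop32iChain.H2IsoEq`
(`MonoidKummerMapsSub.lean`; sub-DAG `plan/L4/SUBDAG-AbsTopIII-Prop32.md` row P32.i.L06; seat abc-iut-w6-d075, row
«P32i-H2ISOEQ-PAIRS»).  `MonoidKummerMapsProp32iH2IsoEqStd.lean` proved it for abc-iut-L4-t2's Kummer theory of
record over the STANDARD closure datum `MLFClosure.std k = (k, AlgebraicClosure k)`.  Here, by the same proof
(nothing in the chain depends on the chosen algebraic closure `K` or on the model datum `D` beyond `k`):

* `Prop121vii.brauerRoute_neg_of` — the Brauer-route composite (orientation `ε = −id`) on a level-`n` class is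
  `inv_n/n`, stated free of the model datum (abc-iut-w4-d045's `modelChainStd_neg_invariant_of`);
* `Prop121vii.closureChain C D R …` : `Prop32iChain (ModelMLFGaloisData.kummerTheoryStd C D R)` for EVERY closure
  datum `C : MLFClosure` (`k = C.k`, `k̄ = C.K` any algebraic closure) with `closureChain_h2IsoEq_iff`,
  `closureChainStd_neg_h2IsoEq`, `not_closureChainStd_refl_h2IsoEq`;
* `GaloisMonoidPair.ModelPresentation.chainStd π R …` : `Prop32iChain (π.kummerTheoryStd R)` for EVERY abstract
  MLF-Galois `TM`-pair `P` presented by `π` (abc-iut-L4-t2's transport `MonoidKummerTransportCanonical.lean` /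
  `MonoidKummerModelH2.lean` — the object level at which (ii)(iii)(v) are booked), with `chainStd_neg_h2IsoEq`;
* **`exists_prop32iChain_h2IsoEq`** — every MLF-Galois `TM`-pair carries a Kummer theory with real `H²`-slot,
  group-theoretic `μ_Ẑ(G)`, recovering the closure, AND a printed chain with `endQmodZ` canonical and `H2IsoEq`.

HONEST FRAMING: local class field theory as proved in the tree; object/model level (the FQ data node is untouched);
nothing here bears on [IUTchIII] Cor. 3.12 or takes a side; typed ≠ proved.
-/

noncomputable section

namespace Literature.AnabelianGeometry.AbsoluteAnabelian

open CategoryTheory Field Function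
open Literature.NumberTheory.GaloisRepresentations
open Literature.NumberTheory.GaloisRepresentations.DiscreteGaloisModule

namespace Prop121vii

/-! ### The Brauer route at orientation `−id`, free of the model datum -/

section Route

variable (k : Type) [Field k] [ValuativeRel k] [TopologicalSpace k] [IsNonarchimedeanLocalField k] [CharZero k]

/-- **The printed Brauer-route composite at orientation `ε = −id` IS the residue map, levelwise**:
`toQmodZ (−(val (Inf⁻¹ (Kummer [x])))) = inv_n(x)/n` for `x ∈ H²(Γ_k, μ_n)` — abc-iut-w4-d045's
`modelChainStd_neg_invariant_of` read free of the model datum (the chain does not involve it).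
[cite: MochizukiAbsTopIII2015, Proposition 3.2 (i) p.71] -/
theorem brauerRoute_neg_of (n : ℕ+) (x : galoisCohomology (mu k (n : ℕ)) 2) :
    ((brauerKummerQZEquiv k).trans ((inflUnrEquiv k).symm.trans ((unrValuationH2Equiv k).trans
      ((AddEquiv.neg _).trans (toQmodZEquiv k))))) (H2MuQZ.of n x) =
      ULift.up ((((((invLevel k (n : ℕ) x).val : ℚ)) / (n : ℕ) : ℚ) : AddCircle (1 : ℚ))) :=
  modelChainStd_neg_invariant_of (D := ModelMLFGaloisData.galois k (AlgebraicClosure k))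
    Prop32iChain.endQmodZCanonical n x

/-- Hence that composite IS `invariantQZEquiv` (as an isomorphism onto `QmodZ`).
[cite: MochizukiAbsTopIII2015, Proposition 3.2 (i) p.71] -/
theorem brauerRoute_neg_eq_invariantQZEquiv :
    (brauerKummerQZEquiv k).trans ((inflUnrEquiv k).symm.trans ((unrValuationH2Equiv k).trans
      ((AddEquiv.neg _).trans (toQmodZEquiv k)))) = (invariantQZEquiv k).trans AddEquiv.ulift.symm :=
  (eq_invariantQZEquiv_iff_levelwise _).2 (brauerRoute_neg_of k)

end Route

/-! ### Every closure datum `C : MLFClosure` -/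

section Closure

variable (C : MLFClosure.{0}) (D : ModelMLFGaloisData C.k C.K) (R : TorsionReciprocityData C.k)

/-- **The printed chain over the Kummer theory of record of ANY closure datum** `C = (k, k̄)`
(`ModelMLFGaloisData.kummerTheoryStd C D R`: `H²`-slot `C.galH2 = H²_cont(G_k, Ẑ(1))`, `h2Iso = C.galH2EquivZhat`):
Brauer arrows over `k = C.k` as in `modelChain`, `homQmodZ := genuineH2HomQmodZEquiv⁻¹ ≫ H²(ψ)`,
`endQmodZ := endQmodZCanonical`. [cite: MochizukiAbsTopIII2015, Proposition 3.2 (i) p.71] -/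
def closureChain (Hmid : Type) [AddCommGroup Hmid]
    (e₃ : (continuousCohomology 2 (((units C.k).quotientInvariants (galUnr C.k)).toTopRep) : TopModuleCat ℤ) ≃+
      Hmid)
    (e₄ : Hmid ≃+ (continuousCohomology 2
      (ContinuousRep.trivial (absoluteGaloisGroup C.k ⧸ galUnr C.k) ℤ ZCoeff.{0}).toTopRep : TopModuleCat ℤ)) :
    Prop32iChain (ModelMLFGaloisData.kummerTheoryStd C D R) where
  H2muQZ := H2MuQZ C.k
  H2Mgp := galoisCohomology (units C.k) 2
  brauerKummer := brauerKummerQZEquiv C.k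
  H2unr := (continuousCohomology 2 (((units C.k).quotientInvariants (galUnr C.k)).toTopRep) : TopModuleCat ℤ)
  inflUnr := inflUnrEquiv C.k
  H2unrVal := Hmid
  unitsAcyclic := e₃
  H2ZhatZ := (continuousCohomology 2
      (ContinuousRep.trivial (absoluteGaloisGroup C.k ⧸ galUnr C.k) ℤ ZCoeff.{0}).toTopRep : TopModuleCat ℤ)
  valGen := e₄
  toQmodZ := toQmodZEquiv C.k
  homQmodZ := (genuineH2HomQmodZEquiv C.k R).symm.trans (galCyclotomeH2EquivGalH2 C.k R)
  endQmodZ := Prop32iChain.endQmodZCanonical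

variable {C D R}

/-- THE CRITERION for a general closure datum: `H2IsoEq` iff the Brauer-route composite IS the residue map.
[cite: MochizukiAbsTopIII2015, Proposition 3.2 (i) p.71] -/
theorem closureChain_h2IsoEq_iff (Hmid : Type) [AddCommGroup Hmid] (e₃) (e₄) :
    (closureChain C D R Hmid e₃ e₄).H2IsoEq ↔
      (closureChain C D R Hmid e₃ e₄).invariant = (invariantQZEquiv C.k).trans AddEquiv.ulift.symm := by
  unfold Prop32iChain.H2IsoEq
  rw [ModelMLFGaloisData.kummerTheoryStd_h2Iso]
  change (MLFClosure.std C.k).galH2EquivZhat = _ ↔ _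
  rw [galH2EquivZhat_eq_trans_genuineH2Iso C.k R]
  exact symm_trans_trans_congr_eq_iff (galCyclotomeH2EquivGalH2 C.k R) (genuineH2HomQmodZEquiv C.k R)
    ((invariantQZEquiv C.k).trans AddEquiv.ulift.symm) (closureChain C D R Hmid e₃ e₄).invariant
    Prop32iChain.endQmodZCanonical (closureChain C D R Hmid e₃ e₄).homInvariant (fun _ => rfl)

variable (C D R)

/-- The chain of a closure datum with every Brauer arrow from the tree (`unitsAcyclic := unrValuationH2Equiv`,
`valGen := ε`). [cite: MochizukiAbsTopIII2015, Proposition 3.2 (i) p.71] -/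
abbrev closureChainStd
    (ε : (continuousCohomology 2
        (ContinuousRep.trivial (absoluteGaloisGroup C.k ⧸ galUnr C.k) ℤ ZCoeff.{0}).toTopRep : TopModuleCat ℤ) ≃+
      (continuousCohomology 2
        (ContinuousRep.trivial (absoluteGaloisGroup C.k ⧸ galUnr C.k) ℤ ZCoeff.{0}).toTopRep : TopModuleCat ℤ)) :
    Prop32iChain (ModelMLFGaloisData.kummerTheoryStd C D R) :=
  closureChain C D R _ (unrValuationH2Equiv C.k) ε

variable {C D R}

/-- **Prop. 3.2 (i) `H2IsoEq` HOLDS for the Kummer theory of record of EVERY closure datum** (orientation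
`ε = −id`, every torsion-reciprocity datum `R`). [cite: MochizukiAbsTopIII2015, Proposition 3.2 (i) p.71] -/
theorem closureChainStd_neg_h2IsoEq : (closureChainStd C D R (AddEquiv.neg _)).H2IsoEq :=
  (closureChain_h2IsoEq_iff (C := C) (D := D) (R := R) _ (unrValuationH2Equiv C.k) (AddEquiv.neg _)).2
    (brauerRoute_neg_eq_invariantQZEquiv C.k)

/-- … and FAILS at the orientation `ε = id` (the tree's sign convention).
[cite: MochizukiAbsTopIII2015, Proposition 3.2 (i) p.71] -/
theorem not_closureChainStd_refl_h2IsoEq : ¬ (closureChainStd C D R (AddEquiv.refl _)).H2IsoEq := by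
  intro h
  have h' := (closureChain_h2IsoEq_iff (C := C) (D := D) (R := R) _ (unrValuationH2Equiv C.k)
    (AddEquiv.refl _)).1 h
  exact not_modelChainStd_refl_h2IsoEq (D := ModelMLFGaloisData.galois C.k (AlgebraicClosure C.k))
    Prop32iChain.endQmodZCanonical
    ((modelChain_h2IsoEq_iff (k := C.k) (D := ModelMLFGaloisData.galois C.k (AlgebraicClosure C.k)) _
      (unrValuationH2Equiv C.k) (AddEquiv.refl _) Prop32iChain.endQmodZCanonical).2 h')

end Closure

end Prop121vii

/-! ### Every abstract MLF-Galois `TM`-pair (object level, by presentation) -/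

namespace GaloisMonoidPair.ModelPresentation

open Prop121vii

variable {P : GaloisMonoidPair.{0}} (π : P.ModelPresentation) (R : TorsionReciprocityData π.C.k)

/-- **The printed chain over the all-slots-real Kummer theory `π.kummerTheoryStd R` of an ABSTRACT MLF-Galois
`TM`-pair** (abc-iut-L4-t2's transport along the presentation `π`; its `H²`-slot / `h2Iso` are `π.C.galH2` /
`π.C.galH2EquivZhat` definitionally): Brauer arrows over `k = π.C.k`, `homQmodZ := genuineH2HomQmodZEquiv⁻¹ ≫ H²(ψ)`,
`endQmodZ := endQmodZCanonical`, `valGen := ε`. [cite: MochizukiAbsTopIII2015, Proposition 3.2 (i) p.71] -/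
def chainStd
    (ε : (continuousCohomology 2
        (ContinuousRep.trivial (absoluteGaloisGroup π.C.k ⧸ galUnr π.C.k) ℤ ZCoeff.{0}).toTopRep : TopModuleCat ℤ) ≃+
      (continuousCohomology 2
        (ContinuousRep.trivial (absoluteGaloisGroup π.C.k ⧸ galUnr π.C.k) ℤ ZCoeff.{0}).toTopRep : TopModuleCat ℤ)) :
    Prop32iChain (π.kummerTheoryStd R) where
  H2muQZ := H2MuQZ π.C.k
  H2Mgp := galoisCohomology (units π.C.k) 2
  brauerKummer := brauerKummerQZEquiv π.C.k
  H2unr := (continuousCohomology 2 (((units π.C.k).quotientInvariants (galUnr π.C.k)).toTopRep) : TopModuleCat ℤ)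
  inflUnr := inflUnrEquiv π.C.k
  H2unrVal := (continuousCohomology 2
      (ContinuousRep.trivial (absoluteGaloisGroup π.C.k ⧸ galUnr π.C.k) ℤ ZCoeff.{0}).toTopRep : TopModuleCat ℤ)
  unitsAcyclic := unrValuationH2Equiv π.C.k
  H2ZhatZ := (continuousCohomology 2
      (ContinuousRep.trivial (absoluteGaloisGroup π.C.k ⧸ galUnr π.C.k) ℤ ZCoeff.{0}).toTopRep : TopModuleCat ℤ)
  valGen := ε
  toQmodZ := toQmodZEquiv π.C.k
  homQmodZ := (genuineH2HomQmodZEquiv π.C.k R).symm.trans (galCyclotomeH2EquivGalH2 π.C.k R)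
  endQmodZ := Prop32iChain.endQmodZCanonical

variable {π R}

/-- THE CRITERION for an abstract pair. [cite: MochizukiAbsTopIII2015, Proposition 3.2 (i) p.71] -/
theorem chainStd_h2IsoEq_iff (ε) :
    (π.chainStd R ε).H2IsoEq ↔
      (π.chainStd R ε).invariant = (invariantQZEquiv π.C.k).trans AddEquiv.ulift.symm := by
  unfold Prop32iChain.H2IsoEq
  rw [kummerTheoryStd_h2Iso]
  change (MLFClosure.std π.C.k).galH2EquivZhat = _ ↔ _
  rw [galH2EquivZhat_eq_trans_genuineH2Iso π.C.k R]
  exact symm_trans_trans_congr_eq_iff (galCyclotomeH2EquivGalH2 π.C.k R) (genuineH2HomQmodZEquiv π.C.k R)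
    ((invariantQZEquiv π.C.k).trans AddEquiv.ulift.symm) (π.chainStd R ε).invariant
    Prop32iChain.endQmodZCanonical (π.chainStd R ε).homInvariant (fun _ => rfl)

/-- **Prop. 3.2 (i) `H2IsoEq` HOLDS for every abstract MLF-Galois `TM`-pair's Kummer theory of record**
(orientation `ε = −id`). [cite: MochizukiAbsTopIII2015, Proposition 3.2 (i) p.71] -/
theorem chainStd_neg_h2IsoEq : (π.chainStd R (AddEquiv.neg _)).H2IsoEq :=
  (chainStd_h2IsoEq_iff (π := π) (R := R) (AddEquiv.neg _)).2 (brauerRoute_neg_eq_invariantQZEquiv π.C.k)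

/-- … and FAILS at `ε = id` (the tree's sign convention). [cite: MochizukiAbsTopIII2015, Proposition 3.2 (i) p.71] -/
theorem not_chainStd_refl_h2IsoEq : ¬ (π.chainStd R (AddEquiv.refl _)).H2IsoEq := by
  intro h
  have h' := (chainStd_h2IsoEq_iff (π := π) (R := R) (AddEquiv.refl _)).1 h
  exact not_modelChainStd_refl_h2IsoEq (D := ModelMLFGaloisData.galois π.C.k (AlgebraicClosure π.C.k))
    Prop32iChain.endQmodZCanonical
    ((modelChain_h2IsoEq_iff (k := π.C.k) (D := ModelMLFGaloisData.galois π.C.k (AlgebraicClosure π.C.k)) _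
      (unrValuationH2Equiv π.C.k) (AddEquiv.refl _) Prop32iChain.endQmodZCanonical).2 h')

end GaloisMonoidPair.ModelPresentation

/-- **[AbsTopIII] Prop. 3.2 (i) WITH its chain statement, unconditionally on every MLF-Galois `TM`-pair
(object level)**: every such pair `P` carries a Kummer theory `T` (abc-iut-L4-t2's `kummerTheoryStd` along a model
presentation: `H²`-slot the real `H²_cont(G_k, Ẑ(1))`, `μ_Ẑ(G)`-slot the group-theoretic `μ_Ẑ(G_k)`, recovering the
closure) AND an instance of the printed chain of (i) over `T` with `End(ℚ/ℤ) ≅ Ẑ` canonical for which `H2IsoEq`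
holds: «the natural isomorphism `H²(G, μ_Ẑ(M_TM)) ⥲ Ẑ`» IS the Brauer chain through «`Hom(ℚ/ℤ, −)`».
[cite: MochizukiAbsTopIII2015, Proposition 3.2 (i) p.71] -/
theorem exists_prop32iChain_h2IsoEq (P : GaloisMonoidPair.{0}) (hP : IsMLFGaloisMonoidPair .TM P) :
    ∃ (π : P.ModelPresentation) (T : MonoidKummerTheory P) (Ch : Prop32iChain T),
      T.coh.H2 = π.C.galH2 ∧ T.muG = muZhat (Field.absoluteGaloisGroup π.C.k) ∧
        T.RecoversClosure π.C (fun m => ((π.iso.isoM.symm m : π.D.tmPair.M) : π.C.K)) ∧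
          Ch.endQmodZ = Prop32iChain.endQmodZCanonical ∧ Ch.H2IsoEq := by
  obtain ⟨π⟩ := GaloisMonoidPair.ModelPresentation.nonempty_iff.mpr hP
  obtain ⟨R⟩ := nonempty_torsionReciprocityData π.C.k
  exact ⟨π, π.kummerTheoryStd R, π.chainStd R (AddEquiv.neg _), rfl, rfl, π.kummerTheoryStd_recoversClosure R, rfl,
    GaloisMonoidPair.ModelPresentation.chainStd_neg_h2IsoEq⟩

end Literature.AnabelianGeometry.AbsoluteAnabelian

end
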